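import Literature.Geometry.Lorentzian.KerrSchildMultiplierDEC
import HarnessLib

/-!
# Coercivity of the energy of a timelike multiplier through a spacelike hypersurface element:
# `−∑_μ (J^X)^μ n_μ ≥ c ∑_μ (∂_μ w)²`, with `c > 0` uniform on compact sets

(family `gr`; infrastructure for the physical-space multiplier estimates behind statement
**gr.S24** — Dafermos–Rodnianski–Shlapentokh-Rothman, arXiv:1402.7034, §3.1, display after (23):
"`∫_{Σ_τ} J^N_μ[ψ] n^μ_{Σ_τ} ∼ ∫ |∂_{t*}ψ|² + |∂_rψ|² + |∇̸ψ|²`" — in the coefficient-field framework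
of `KerrSchild.waveOperator`; namespace `Literature.Geometry.Lorentzian.KerrSchild`)

`KerrSchildMultiplierDEC.lean` proves the *sign* `0 ≤ −∑_μ (J^X)^μ n_μ` of the energy of a timelike
multiplier `X = ξ♯` through a hypersurface element with causal conormal `n` (dominant energy
condition). For the energy estimates of DRSR one needs the *quantitative* form: when `n` is
timelike as well (a uniformly spacelike hypersurface, e.g. the leaves `Σ_τ`), the energy density
controls all derivatives, `J^N_μ n^μ ≥ c |∂ψ|²`, with `c` depending only on the geometry
("`B` depends only on `a₀`, `M`", loc. cit. §3.1 and §4.2). This file proves: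

* `KerrSchild.dec_bilin_pos` — the **strict** dominant energy condition: for a symmetric bilinear
  form `B` with `B(ξ, ξ) < 0`, `B` positive *definite* on `ξ^⊥`, `B(ν, ν) < 0`, `B(ξ, ν) < 0` and
  `p ≠ 0`: `0 < B(ν, p) B(ξ, p) − ½ B(ν, ξ) B(p, p)`;
* `KerrSchild.pos_on_orthogonal_of_timelike` — positive definiteness on `ξ^⊥` transfers to every
  timelike `ξ'` (Sylvester), so it is a property of `B` alone;
* `KerrSchild.exists_pos_mul_sum_sq_le` — **compactness ⇒ coercivity**: a family of quadratic-type
  functions `Q(x, p)` on `ℝ⁴`, jointly continuous, `2`-homogeneous in `p` and positive for `p ≠ 0`,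
  over a compact parameter set `K`, is uniformly coercive: `∃ c > 0, ∀ x ∈ K, c ∑ p_μ² ≤ Q(x, p)`
  (minimum over `K × {∑ p² = 1}`);
* `KerrSchild.exists_pos_mul_sum_sq_le_neg_sum_multiplierCurrent_mul` — **uniform coercivity of
  the `X`-energy density**: for continuous symmetric coefficients `G`, continuous covector fields
  `ξ` (with `X = ξ♯` timelike, `G` positive definite on `ξ^⊥`) and `n` (timelike, `n(X) > 0`) on a
  compact set `K`, there is `c > 0` with
  `c ∑_μ (∂_μw)²(x) ≤ −∑_μ (J^X)^μ(x) n_μ(x)` for all `x ∈ K` and all `w`; together with the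
  trivial upper bound this is `J^N_μ n^μ ∼ ∑ (∂ψ)²` of DRSR §3.1 with constants depending only on
  the geometry of `K`.

## References

* M. Dafermos, I. Rodnianski, Y. Shlapentokh-Rothman, arXiv:1402.7034 = Ann. of Math. 183 (2016),
  §3.1 (display after (23)), §4.2 (key `DafermosRodnianskiShlapentokhrothman2014`).
* S. W. Hawking, G. F. R. Ellis, *The large scale structure of space-time*, CUP 1973, §4.3
  (key `HawkingEllis1973CUP`).
-/

noncomputable section

open Set Filter
open scoped ContDiff Topology

namespace Literature.Geometry.Lorentzian

namespace KerrSchild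

/-! ### The strict dominant energy condition -/

section Bilin

variable {V : Type*} [AddCommGroup V] [Module ℝ V]

/-- **The strict dominant energy condition, algebraic form.** For a symmetric bilinear form `B`
with `B(ξ, ξ) < 0`, `B` positive definite on `ξ^⊥`, a timelike `ν` in the cone of `ξ`
(`B(ν, ν) < 0`, `B(ξ, ν) < 0`) and `p ≠ 0`: `0 < B(ν, p) B(ξ, p) − ½ B(ν, ξ) B(p, p)` — the
stress–energy form `T[p](ν♯, ξ♯)` of a non-zero covector between two timelike vectors of the same
cone is positive (Hawking–Ellis 1973, §4.3). [cite: HawkingEllis1973CUP, §4.3] -/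
theorem dec_bilin_pos (B : LinearMap.BilinForm ℝ V) (hB : ∀ u v, B u v = B v u) (ξ ν p : V)
    (hξ : B ξ ξ < 0) (hpos : ∀ u, B ξ u = 0 → u ≠ 0 → 0 < B u u) (hν : B ν ν < 0)
    (hco : B ξ ν < 0) (hp : p ≠ 0) :
    0 < B ν p * B ξ p - 2⁻¹ * B ν ξ * B p p := by
  have hsig : ∀ u, B ξ u = 0 → 0 ≤ B u u := fun u hu ↦ by
    rcases eq_or_ne u 0 with h | h
    · rw [h]; simp
    · exact (hpos u hu h).le
  -- notation: `a = B(ξ,ξ) < 0`, `α = B(ν,ξ)/a`, `e = ν − αξ`, `l = B(p,ξ)/a`, `u = p − lξ`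
  have ha0 : B ξ ξ ≠ 0 := ne_of_lt hξ
  obtain ⟨a, ha⟩ : ∃ a : ℝ, B ξ ξ = a := ⟨_, rfl⟩
  obtain ⟨α, hα⟩ : ∃ α : ℝ, α = B ν ξ / a := ⟨_, rfl⟩
  obtain ⟨l, hl⟩ : ∃ l : ℝ, l = B p ξ / a := ⟨_, rfl⟩
  obtain ⟨e, he_def⟩ : ∃ e : V, e = ν - α • ξ := ⟨_, rfl⟩
  obtain ⟨u, hu_def⟩ : ∃ u : V, u = p - l • ξ := ⟨_, rfl⟩
  rw [ha] at hξ ha0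
  -- orthogonality
  have he : B ξ e = 0 := by
    rw [he_def, map_sub, map_smul, smul_eq_mul, hB ξ ν, hα, ha]
    field_simp
    ring
  have hu : B ξ u = 0 := by
    rw [hu_def, map_sub, map_smul, smul_eq_mul, hB ξ p, hl, ha]
    field_simp
    ring
  have heξ : B e ξ = 0 := by rw [hB]; exact he
  have huξ : B u ξ = 0 := by rw [hB]; exact hu
  -- the decompositions
  have hν' : ν = α • ξ + e := by rw [he_def]; abel
  have hp' : p = l • ξ + u := by rw [hu_def]; abel
  have hνξ : B ν ξ = α * a := by
    rw [hν', map_add, map_smul, LinearMap.add_apply, LinearMap.smul_apply, smul_eq_mul, ha, heξ]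
    ring
  have hξp : B ξ p = l * a := by
    rw [hp', map_add, map_smul, smul_eq_mul, ha, hu]
    ring
  have hνp : B ν p = α * l * a + B e u := by
    rw [hν', hp']
    simp only [map_add, map_smul, LinearMap.add_apply, LinearMap.smul_apply, smul_eq_mul, ha,
      hu, heξ]
    ring
  have hpp : B p p = l ^ 2 * a + B u u := by
    rw [hp']
    simp only [map_add, map_smul, LinearMap.add_apply, LinearMap.smul_apply, smul_eq_mul, ha,
      hu, huξ]
    ring
  -- signs
  have hα_pos : 0 < α := by
    rw [hα, hB ν ξ]
    exact div_pos_of_neg_of_neg hco hξ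
  have hee : B e e < α ^ 2 * (-a) := by
    have h := hν
    rw [hν'] at h
    simp only [map_add, map_smul, LinearMap.add_apply, LinearMap.smul_apply, smul_eq_mul, ha,
      he, heξ] at h
    nlinarith [h]
  have heu : B e u = B u e := hB e u
  -- the value of `T`
  have hT : B ν p * B ξ p - 2⁻¹ * B ν ξ * B p p =
      α * l ^ 2 * a ^ 2 / 2 + l * a * B u e + α * (-a) * B u u / 2 := by
    rw [hνp, hξp, hνξ, hpp, heu]
    ring
  rw [hT]
  rcases eq_or_ne u 0 with hu0 | hu0
  · -- `p = lξ` with `l ≠ 0`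
    have hl0 : l ≠ 0 := by
      intro h
      apply hp
      rw [hp', h, hu0, zero_smul, add_zero]
    have h0 : B u e = 0 := by rw [hu0]; simp
    have h1 : B u u = 0 := by rw [hu0]; simp
    rw [h0, h1]
    have hl2 : 0 < l ^ 2 := lt_of_le_of_ne (sq_nonneg l) (Ne.symm (pow_ne_zero 2 hl0))
    have ha2 : 0 < a ^ 2 := lt_of_le_of_ne (sq_nonneg a) (Ne.symm (pow_ne_zero 2 ha0))
    nlinarith [mul_pos (mul_pos hα_pos hl2) ha2]
  · have huu : 0 < B u u := hpos u hu hu0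
    have hCS := sq_bilin_le_of_orthogonal B hB ξ hsig hu he
    have hm : B u e ^ 2 < α ^ 2 * (-a) * B u u := by
      calc B u e ^ 2 ≤ B u u * B e e := hCS
        _ < B u u * (α ^ 2 * (-a)) := mul_lt_mul_of_pos_left hee huu
        _ = α ^ 2 * (-a) * B u u := by ring
    have h2 : 0 < 2 * α * (α * l ^ 2 * a ^ 2 / 2 + l * a * B u e + α * (-a) * B u u / 2) := by
      nlinarith [sq_nonneg (α * l * a + B u e), hm]
    by_contra hle
    rw [not_lt] at hle
    nlinarith [mul_nonpos_of_nonneg_of_nonpos (by linarith : (0 : ℝ) ≤ 2 * α) hle]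

/-- **Positive definiteness on the orthogonal complement is independent of the time axis**: if
`B` is symmetric and positive definite on `ξ^⊥`, and `ξ'` is timelike (`B(ξ', ξ') < 0`), then
`B` is positive definite on `ξ'^⊥` (Sylvester's law of inertia). [folklore] -/
theorem pos_on_orthogonal_of_timelike (B : LinearMap.BilinForm ℝ V) (hB : ∀ u v, B u v = B v u)
    {ξ ξ' : V} (hpos : ∀ u, B ξ u = 0 → u ≠ 0 → 0 < B u u) (hξ' : B ξ' ξ' < 0) :
    ∀ u, B ξ' u = 0 → u ≠ 0 → 0 < B u u := by
  intro u hu hune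
  by_contra hneg
  rw [not_lt] at hneg
  have huξ' : B u ξ' = 0 := by rw [hB]; exact hu
  -- the vector `v = B(ξ,u) ξ' − B(ξ,ξ') u` is orthogonal to `ξ` and `B(v,v) ≤ 0`
  have hv : B ξ (B ξ u • ξ' - B ξ ξ' • u) = 0 := by
    rw [map_sub, map_smul, map_smul, smul_eq_mul, smul_eq_mul]
    ring
  have hvv : B (B ξ u • ξ' - B ξ ξ' • u) (B ξ u • ξ' - B ξ ξ' • u) =
      B ξ u ^ 2 * B ξ' ξ' + B ξ ξ' ^ 2 * B u u := by
    simp only [map_sub, map_smul, LinearMap.sub_apply, LinearMap.smul_apply, smul_eq_mul, hu,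
      huξ']
    ring
  have hv0 : B ξ u • ξ' - B ξ ξ' • u = 0 := by
    by_contra hvne
    have h := hpos _ hv hvne
    rw [hvv] at h
    nlinarith [sq_nonneg (B ξ u), sq_nonneg (B ξ ξ'), mul_nonneg (sq_nonneg (B ξ u)) (neg_nonneg.mpr hξ'.le),
      mul_nonneg (sq_nonneg (B ξ ξ')) (neg_nonneg.mpr hneg)]
  rcases eq_or_ne (B ξ ξ') 0 with h0 | h0
  · -- `ξ' ⊥ ξ`, `ξ' ≠ 0`: contradiction with `B(ξ',ξ') < 0`
    have hξ'ne : ξ' ≠ 0 := by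
      intro h
      rw [h] at hξ'
      simp at hξ'
    linarith [hpos ξ' h0 hξ'ne]
  · -- apply `B(ξ', ·)` to `v = 0`: `B(ξ,u) B(ξ',ξ') = 0`, so `B(ξ,u) = 0`, so `u = 0`
    have h1 : B ξ' (B ξ u • ξ' - B ξ ξ' • u) = 0 := by rw [hv0]; simp
    rw [map_sub, map_smul, map_smul, smul_eq_mul, smul_eq_mul, hu, mul_zero, sub_zero] at h1
    have h2 : B ξ u = 0 := by
      rcases mul_eq_zero.mp h1 with h | h
      · exact h
      · exact absurd h (ne_of_lt hξ')
    rw [h2, zero_smul, zero_sub, neg_eq_zero, smul_eq_zero] at hv0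
    rcases hv0 with h | h
    · exact h0 h
    · exact hune h

end Bilin

/-! ### Compactness gives uniform coercivity -/

/-- **Uniform coercivity from positivity and compactness.** Let `K` be a compact subset of a
topological space and `Q : α → (Fin 4 → ℝ) → ℝ` jointly continuous on `K × ℝ⁴`, homogeneous of
degree `2` in the second variable and positive away from `p = 0`, for `x ∈ K`. Then there is a
single `c > 0` with `c ∑_μ p_μ² ≤ Q(x, p)` for all `x ∈ K` and all `p` (the minimum of `Q` over the
compact set `K × {∑ p² = 1}`). [folklore] -/
theorem exists_pos_mul_sum_sq_le {α : Type*} [TopologicalSpace α] {K : Set α} (hK : IsCompact K)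
    {Q : α → (Fin 4 → ℝ) → ℝ}
    (hQ : ContinuousOn (fun z : α × (Fin 4 → ℝ) ↦ Q z.1 z.2) (K ×ˢ Set.univ))
    (hhom : ∀ x ∈ K, ∀ (c : ℝ) (p : Fin 4 → ℝ), Q x (c • p) = c ^ 2 * Q x p)
    (hpos : ∀ x ∈ K, ∀ p : Fin 4 → ℝ, p ≠ 0 → 0 < Q x p) :
    ∃ c : ℝ, 0 < c ∧ ∀ x ∈ K, ∀ p : Fin 4 → ℝ, c * ∑ μ, p μ ^ 2 ≤ Q x p := by
  -- `Q x 0 = 0`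
  have hQ0 : ∀ x ∈ K, Q x 0 = 0 := fun x hx ↦ by
    have h := hhom x hx 0 0
    rw [zero_smul, zero_pow two_ne_zero, zero_mul] at h
    exact h
  rcases K.eq_empty_or_nonempty with hKe | ⟨x₀, hx₀⟩
  · exact ⟨1, one_pos, fun x hx ↦ by simp [hKe] at hx⟩
  -- the unit sphere of `∑ p²`
  set S : Set (Fin 4 → ℝ) := {p | ∑ μ, p μ ^ 2 = 1} with hS
  have hSclosed : IsClosed S :=
    isClosed_eq (continuous_finsetSum _ fun μ _ ↦ (continuous_apply μ).pow 2) continuous_const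
  have hSbdd : Bornology.IsBounded S := by
    refine (Metric.isBounded_closedBall (x := (0 : Fin 4 → ℝ)) (r := 1)).subset fun p hp ↦ ?_
    rw [Metric.mem_closedBall, dist_zero_right, pi_norm_le_iff_of_nonneg zero_le_one]
    intro μ
    rw [Real.norm_eq_abs, abs_le_one_iff_mul_self_le_one, ← sq, ← hp]
    exact Finset.single_le_sum (f := fun μ ↦ p μ ^ 2) (fun ν _ ↦ sq_nonneg (p ν))
      (Finset.mem_univ μ)
  have hScomp : IsCompact S := Metric.isCompact_of_isClosed_isBounded hSclosed hSbdd
  obtain ⟨e₀, he₀⟩ : ∃ e₀ : Fin 4 → ℝ, e₀ = fun μ ↦ if μ = 0 then 1 else 0 := ⟨_, rfl⟩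
  have he₀S : e₀ ∈ S := by
    rw [hS, Set.mem_setOf_eq, he₀]
    simp
  have hKS : IsCompact (K ×ˢ S) := hK.prod hScomp
  have hne : (K ×ˢ S).Nonempty := ⟨(x₀, e₀), hx₀, he₀S⟩
  have hcont : ContinuousOn (fun z : α × (Fin 4 → ℝ) ↦ Q z.1 z.2) (K ×ˢ S) :=
    hQ.mono (Set.prod_mono le_rfl (Set.subset_univ _))
  obtain ⟨z, hz, hmin⟩ := hKS.exists_isMinOn hne hcont
  have hz2 : z.2 ≠ 0 := by
    intro h
    have := hz.2
    rw [hS, Set.mem_setOf_eq, h] at this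
    simp at this
  refine ⟨Q z.1 z.2, hpos z.1 hz.1 z.2 hz2, fun x hx p ↦ ?_⟩
  rcases eq_or_ne p 0 with hp | hp
  · rw [hp, hQ0 x hx]; simp
  · -- normalise `p`
    have hsp : 0 < ∑ μ, p μ ^ 2 := by
      obtain ⟨μ, hμ⟩ : ∃ μ, p μ ≠ 0 := by
        by_contra h
        exact hp (funext fun μ ↦ not_not.mp (not_exists.mp h μ))
      exact lt_of_lt_of_le (by positivity) (Finset.single_le_sum (f := fun μ ↦ p μ ^ 2)
        (fun ν _ ↦ sq_nonneg (p ν)) (Finset.mem_univ μ))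
    set t : ℝ := Real.sqrt (∑ μ, p μ ^ 2) with ht
    have ht0 : 0 < t := Real.sqrt_pos.mpr hsp
    have htt : t ^ 2 = ∑ μ, p μ ^ 2 := Real.sq_sqrt hsp.le
    have hqS : t⁻¹ • p ∈ S := by
      rw [hS, Set.mem_setOf_eq]
      simp only [Pi.smul_apply, smul_eq_mul, mul_pow, ← Finset.mul_sum, ← htt, inv_pow]
      exact inv_mul_cancel₀ (pow_ne_zero 2 ht0.ne')
    have hmin' : Q z.1 z.2 ≤ Q x (t⁻¹ • p) := (isMinOn_iff.mp hmin) (x, t⁻¹ • p) ⟨hx, hqS⟩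
    have hpq : p = t • (t⁻¹ • p) := by
      rw [smul_smul, mul_inv_cancel₀ ht0.ne', one_smul]
    have h3 : Q x p = t ^ 2 * Q x (t⁻¹ • p) := by
      conv_lhs => rw [hpq]
      exact hhom x hx t _
    calc Q z.1 z.2 * ∑ μ, p μ ^ 2 = Q z.1 z.2 * t ^ 2 := by rw [htt]
      _ ≤ Q x (t⁻¹ • p) * t ^ 2 := mul_le_mul_of_nonneg_right hmin' (sq_nonneg t)
      _ = Q x p := by rw [h3]; ring

/-! ### Uniform coercivity of the energy of a timelike multiplier -/

/-- **`J^N_μ n^μ ≳ ∑ (∂ψ)²`, uniformly on compact sets** (DRSR arXiv:1402.7034, §3.1, display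
after (23), and §4.2: constants depending only on the geometry). Let `G` be a continuous symmetric
coefficient field, `ξ` and `n` continuous covector fields, and `K` a compact set on which
`G(ξ, ξ) < 0` with `G` positive definite on `ξ^⊥` (the multiplier `X = ξ♯` is timelike),
`G(n, n) < 0` (the hypersurface elements with conormal `n` are uniformly spacelike) and
`G(ξ, n) = n(X) > 0` (co-orientation). Then there is `c > 0` such that for every `x ∈ K`, every
multiplier `X` with `X^α(x) = ∑_β G^{αβ}(x) ξ_β(x)` and every function `w`,
`c ∑_μ (∂_μ w)²(x) ≤ −∑_μ (J^X)^μ(x) n_μ(x)`. [cite: DafermosRodnianskiShlapentokhrothman2014, §3.1] -/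
theorem exists_pos_mul_sum_sq_le_neg_sum_multiplierCurrent_mul {G : E4 → Fin 4 → Fin 4 → ℝ}
    {ξ n : E4 → Fin 4 → ℝ} {K : Set E4} (hK : IsCompact K)
    (hG : ∀ μ ν, Continuous fun x ↦ G x μ ν) (hsymm : ∀ x μ ν, G x μ ν = G x ν μ)
    (hξc : ∀ α, Continuous fun x ↦ ξ x α) (hnc : ∀ α, Continuous fun x ↦ n x α)
    (hξ : ∀ x ∈ K, Matrix.toBilin' (G x) (ξ x) (ξ x) < 0)
    (hpos : ∀ x ∈ K, ∀ u, Matrix.toBilin' (G x) (ξ x) u = 0 → u ≠ 0 →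
      0 < Matrix.toBilin' (G x) u u)
    (hn : ∀ x ∈ K, Matrix.toBilin' (G x) (n x) (n x) < 0)
    (hco : ∀ x ∈ K, 0 < Matrix.toBilin' (G x) (ξ x) (n x)) :
    ∃ c : ℝ, 0 < c ∧ ∀ x ∈ K, ∀ (X : E4 → Fin 4 → ℝ) (w : E4 → ℝ),
      (∀ α, X x α = ∑ β, G x α β * ξ x β) →
        c * ∑ μ, fderiv ℝ w x (E4.basisVector μ) ^ 2 ≤
          -∑ μ, multiplierCurrent G X w x μ * n x μ := by
  -- the quadratic form `Q(x, p) = −T[p](n♯, ξ♯)`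
  obtain ⟨Q, hQ⟩ : ∃ Q : E4 → (Fin 4 → ℝ) → ℝ, ∀ x p, Q x p =
      -(Matrix.toBilin' (G x) (n x) p * Matrix.toBilin' (G x) (ξ x) p -
        2⁻¹ * Matrix.toBilin' (G x) (n x) (ξ x) * Matrix.toBilin' (G x) p p) :=
    ⟨_, fun _ _ ↦ rfl⟩
  -- continuity
  have hB : ∀ (u v : E4 × (Fin 4 → ℝ) → Fin 4 → ℝ), Continuous u → Continuous v →
      Continuous fun z : E4 × (Fin 4 → ℝ) ↦ Matrix.toBilin' (G z.1) (u z) (v z) := by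
    intro u v hu hv
    simp only [Matrix.toBilin'_apply]
    refine continuous_finsetSum _ fun i _ ↦ continuous_finsetSum _ fun j _ ↦ ?_
    exact (((continuous_apply i).comp hu).mul ((hG i j).comp continuous_fst)).mul
      ((continuous_apply j).comp hv)
  have hξz : Continuous fun z : E4 × (Fin 4 → ℝ) ↦ ξ z.1 :=
    continuous_pi fun α ↦ (hξc α).comp continuous_fst
  have hnz : Continuous fun z : E4 × (Fin 4 → ℝ) ↦ n z.1 :=
    continuous_pi fun α ↦ (hnc α).comp continuous_fst
  have hQc : ContinuousOn (fun z : E4 × (Fin 4 → ℝ) ↦ Q z.1 z.2) (K ×ˢ Set.univ) := by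
    have h : (fun z : E4 × (Fin 4 → ℝ) ↦ Q z.1 z.2) = fun z ↦
        -(Matrix.toBilin' (G z.1) (n z.1) z.2 * Matrix.toBilin' (G z.1) (ξ z.1) z.2 -
          2⁻¹ * Matrix.toBilin' (G z.1) (n z.1) (ξ z.1) * Matrix.toBilin' (G z.1) z.2 z.2) :=
      funext fun z ↦ hQ _ _
    rw [h]
    exact (((hB _ _ hnz continuous_snd).mul (hB _ _ hξz continuous_snd)).sub
      ((continuous_const.mul (hB _ _ hnz hξz)).mul (hB _ _ continuous_snd continuous_snd))).neg
        |>.continuousOn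
  -- homogeneity
  have hhom : ∀ x ∈ K, ∀ (c : ℝ) (p : Fin 4 → ℝ), Q x (c • p) = c ^ 2 * Q x p := by
    intro x _ c p
    simp only [hQ, map_smul, LinearMap.smul_apply, smul_eq_mul]
    ring
  -- positivity: the strict dominant energy condition with `ν = −n`
  have hposQ : ∀ x ∈ K, ∀ p : Fin 4 → ℝ, p ≠ 0 → 0 < Q x p := by
    intro x hx p hp
    have h := dec_bilin_pos (Matrix.toBilin' (G x)) (toBilin'_symm (G x) (hsymm x)) (ξ x) (-(n x)) p
      (hξ x hx) (hpos x hx) (by simpa using hn x hx) (by simpa using hco x hx) hp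
    rw [hQ]
    simp only [map_neg, LinearMap.neg_apply] at h
    linarith
  obtain ⟨c, hc, hcQ⟩ := exists_pos_mul_sum_sq_le hK hQc hhom hposQ
  refine ⟨c, hc, fun x hx X w hX ↦ ?_⟩
  have h := hcQ x hx (fun κ ↦ fderiv ℝ w x (E4.basisVector κ))
  rw [hQ] at h
  rw [sum_multiplierCurrent_mul_eq w (hsymm x) hX (n x)]
  exact h

/-- **The trivial upper bound `|∑_μ (J^X)^μ n_μ| ≤ C ∑ (∂w)²`, uniformly on compact sets**: for
continuous `G`, `ξ`, `n` and compact `K` there is `C` with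
`|∑_μ (J^X)^μ(x) n_μ(x)| ≤ C ∑_μ (∂_μw)²(x)` for `x ∈ K`, `X = ξ♯` (continuity of the quadratic
form on `K × {∑ p² = 1}`; the other half of `J^N_μ n^μ ∼ ∑(∂ψ)²`, DRSR arXiv:1402.7034, §3.1).
[cite: DafermosRodnianskiShlapentokhrothman2014, §3.1] -/
theorem exists_abs_sum_multiplierCurrent_mul_le {G : E4 → Fin 4 → Fin 4 → ℝ}
    {ξ n : E4 → Fin 4 → ℝ} {K : Set E4} (hK : IsCompact K)
    (hG : ∀ μ ν, Continuous fun x ↦ G x μ ν) (hsymm : ∀ x μ ν, G x μ ν = G x ν μ)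
    (hξc : ∀ α, Continuous fun x ↦ ξ x α) (hnc : ∀ α, Continuous fun x ↦ n x α) :
    ∃ C : ℝ, ∀ x ∈ K, ∀ (X : E4 → Fin 4 → ℝ) (w : E4 → ℝ),
      (∀ α, X x α = ∑ β, G x α β * ξ x β) →
        |∑ μ, multiplierCurrent G X w x μ * n x μ| ≤
          C * ∑ μ, fderiv ℝ w x (E4.basisVector μ) ^ 2 := by
  -- the quadratic form `T(x, p)` plus `∑ p²` is positive: coercivity of `T + A ∑p²` for large `A`
  -- is not needed; instead bound `|T| ≤ C` on the sphere directly via compactness of `K × S`.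
  obtain ⟨T, hT⟩ : ∃ T : E4 → (Fin 4 → ℝ) → ℝ, ∀ x p, T x p =
      Matrix.toBilin' (G x) (n x) p * Matrix.toBilin' (G x) (ξ x) p -
        2⁻¹ * Matrix.toBilin' (G x) (n x) (ξ x) * Matrix.toBilin' (G x) p p :=
    ⟨_, fun _ _ ↦ rfl⟩
  have hB : ∀ (u v : E4 × (Fin 4 → ℝ) → Fin 4 → ℝ), Continuous u → Continuous v →
      Continuous fun z : E4 × (Fin 4 → ℝ) ↦ Matrix.toBilin' (G z.1) (u z) (v z) := by
    intro u v hu hv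
    simp only [Matrix.toBilin'_apply]
    refine continuous_finsetSum _ fun i _ ↦ continuous_finsetSum _ fun j _ ↦ ?_
    exact (((continuous_apply i).comp hu).mul ((hG i j).comp continuous_fst)).mul
      ((continuous_apply j).comp hv)
  have hξz : Continuous fun z : E4 × (Fin 4 → ℝ) ↦ ξ z.1 :=
    continuous_pi fun α ↦ (hξc α).comp continuous_fst
  have hnz : Continuous fun z : E4 × (Fin 4 → ℝ) ↦ n z.1 :=
    continuous_pi fun α ↦ (hnc α).comp continuous_fst
  have hTc : Continuous (fun z : E4 × (Fin 4 → ℝ) ↦ T z.1 z.2) := by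
    have h : (fun z : E4 × (Fin 4 → ℝ) ↦ T z.1 z.2) = fun z ↦
        Matrix.toBilin' (G z.1) (n z.1) z.2 * Matrix.toBilin' (G z.1) (ξ z.1) z.2 -
          2⁻¹ * Matrix.toBilin' (G z.1) (n z.1) (ξ z.1) * Matrix.toBilin' (G z.1) z.2 z.2 :=
      funext fun z ↦ hT _ _
    rw [h]
    exact ((hB _ _ hnz continuous_snd).mul (hB _ _ hξz continuous_snd)).sub
      ((continuous_const.mul (hB _ _ hnz hξz)).mul (hB _ _ continuous_snd continuous_snd))
  have hhom : ∀ x (c : ℝ) (p : Fin 4 → ℝ), T x (c • p) = c ^ 2 * T x p := by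
    intro x c p
    simp only [hT, map_smul, LinearMap.smul_apply, smul_eq_mul]
    ring
  -- apply the coercivity lemma to `Q± = A ∑ p² ± T` with `A` a bound for `|T|` on `K × S`, via the
  -- simpler route: `|T| ≤ A` on the sphere, then homogeneity.
  set S : Set (Fin 4 → ℝ) := {p | ∑ μ, p μ ^ 2 = 1} with hS
  have hSclosed : IsClosed S :=
    isClosed_eq (continuous_finsetSum _ fun μ _ ↦ (continuous_apply μ).pow 2) continuous_const
  have hSbdd : Bornology.IsBounded S := by
    refine (Metric.isBounded_closedBall (x := (0 : Fin 4 → ℝ)) (r := 1)).subset fun p hp ↦ ?_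
    rw [Metric.mem_closedBall, dist_zero_right, pi_norm_le_iff_of_nonneg zero_le_one]
    intro μ
    rw [Real.norm_eq_abs, abs_le_one_iff_mul_self_le_one, ← sq, ← hp]
    exact Finset.single_le_sum (f := fun μ ↦ p μ ^ 2) (fun ν _ ↦ sq_nonneg (p ν))
      (Finset.mem_univ μ)
  have hKS : IsCompact (K ×ˢ S) := hK.prod (Metric.isCompact_of_isClosed_isBounded hSclosed hSbdd)
  obtain ⟨A, hA⟩ := hKS.exists_bound_of_continuousOn (f := fun z : E4 × (Fin 4 → ℝ) ↦ T z.1 z.2)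
    hTc.continuousOn
  refine ⟨max A 0, fun x hx X w hX ↦ ?_⟩
  rw [sum_multiplierCurrent_mul_eq w (hsymm x) hX (n x), ← hT]
  set p : Fin 4 → ℝ := fun κ ↦ fderiv ℝ w x (E4.basisVector κ) with hp_def
  rcases eq_or_ne p 0 with hp | hp
  · have h0 : T x 0 = 0 := by
      have h := hhom x 0 0
      rw [zero_smul, zero_pow two_ne_zero, zero_mul] at h
      exact h
    rw [hp, h0, abs_zero]
    exact mul_nonneg (le_max_right _ _) (Finset.sum_nonneg fun _ _ ↦ sq_nonneg _)
  · have hsp : 0 < ∑ μ, p μ ^ 2 := by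
      obtain ⟨μ, hμ⟩ : ∃ μ, p μ ≠ 0 := by
        by_contra h
        exact hp (funext fun μ ↦ not_not.mp (not_exists.mp h μ))
      exact lt_of_lt_of_le (by positivity) (Finset.single_le_sum (f := fun μ ↦ p μ ^ 2)
        (fun ν _ ↦ sq_nonneg (p ν)) (Finset.mem_univ μ))
    set t : ℝ := Real.sqrt (∑ μ, p μ ^ 2) with ht
    have ht0 : 0 < t := Real.sqrt_pos.mpr hsp
    have htt : t ^ 2 = ∑ μ, p μ ^ 2 := Real.sq_sqrt hsp.le
    have hqS : t⁻¹ • p ∈ S := by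
      rw [hS, Set.mem_setOf_eq]
      simp only [Pi.smul_apply, smul_eq_mul, mul_pow, ← Finset.mul_sum, ← htt, inv_pow]
      exact inv_mul_cancel₀ (pow_ne_zero 2 ht0.ne')
    have hAq : |T x (t⁻¹ • p)| ≤ max A 0 := by
      have h := hA (x, t⁻¹ • p) ⟨hx, hqS⟩
      rw [Real.norm_eq_abs] at h
      exact h.trans (le_max_left _ _)
    have hpq : p = t • (t⁻¹ • p) := by
      rw [smul_smul, mul_inv_cancel₀ ht0.ne', one_smul]
    have h3 : T x p = t ^ 2 * T x (t⁻¹ • p) := by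
      conv_lhs => rw [hpq]
      exact hhom x t _
    calc |T x p| = |T x (t⁻¹ • p)| * t ^ 2 := by
          rw [h3, abs_mul, abs_of_nonneg (sq_nonneg t)]
          ring
      _ ≤ max A 0 * t ^ 2 := mul_le_mul_of_nonneg_right hAq (sq_nonneg t)
      _ = max A 0 * ∑ μ, p μ ^ 2 := by rw [htt]

end KerrSchild

end Literature.Geometry.Lorentzian
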